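import Mathlib.LinearAlgebra.BilinearForm.Properties
import Mathlib.LinearAlgebra.FiniteDimensional.Defs
import Mathlib.LinearAlgebra.GeneralLinearGroup.Basic
import Mathlib.LinearAlgebra.LinearIndependent.Defs
import Mathlib.GroupTheory.Index
import HarnessLib

/-!
# Skew-symmetric vanishing lattices and their monodromy groups (Janssen), in Schnell's form

Topic `Literature/AlgebraicGeometry/HodgeTheory` (consumer: crux `LocalTubeSpan` of route
`LinearSystemTorelli` of the Hodge summit, and the tube-mapping package
`LocallyTrivialExtensionClasses`). The vocabulary of W. Janssen, *Skew-symmetric vanishing lattices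
and their monodromy groups*, Math. Ann. 266 (1983) 115–133, exactly as recalled and used in
C. Schnell, *Primitive cohomology and the tube mapping*, Math. Z. 268 (2010) (= arXiv:0711.3927) §7
"Skew-symmetric vanishing lattices" [Schnell2010]:

> "Let `V` be a free `ℤ`-module of finite rank, with an alternating bilinear form `B`. […] For every
> element `v ∈ V`, we can define a symplectic transvection `T_v` by the formula
> `T_v(x) = x - ⟨x, v⟩ v`. […] Given a subset `Δ ⊆ V`, we write `Γ_Δ` for the subgroup generated by
> all `T_δ`, for `δ ∈ Δ`. […] A (skew-symmetric) vanishing lattice in `V` is a subset `Δ ⊆ V` with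
> the following three properties: the set `Δ` generates `V`; `Δ` is a single orbit under the action
> of `Γ_Δ`; there exist two elements `δ₁, δ₂ ∈ Δ` such that `⟨δ₁, δ₂⟩ = 1`. In that case, `Γ_Δ` is
> called the monodromy group of the vanishing lattice."

The integral vanishing cohomology `Hⁿ(X_s, ℤ)_van` (mod torsion) of the smooth hyperplane sections
of an even-dimensional variety, with `Δ` = all vanishing cycles, is the example ([Schnell2010] §7,
"Conclusion of the argument": one orbit by Zariski/irreducibility of the dual variety, a pair with
intersection number one by loc. cit. §5 Lemma 6).

## Design (rational form)

The consumers work with `ℚ`-vector spaces (`Hⁿ(X_s, ℚ)_van`, Mathlib group cohomology over a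
field), so everything is stated for a module `V` over a commutative ring `K` with a bilinear form
`B : LinearMap.BilinForm K V`, and the `ℤ`-structure of Janssen/Schnell is recorded as the
FINITE GENERATION of `ℤ·Δ` and INTEGRALITY of `B` on `Δ` (`IsSkewVanishingLattice.fg`,
`.integral`): for `K = ℚ` Schnell's free `ℤ`-module is `V_ℤ := ℤ·Δ` (finitely generated and
torsion-free, hence free, of rank `dim_ℚ V` because `Δ` spans; carrying the integral alternating
form `B|_{V_ℤ}`; generated by `Δ` by definition; preserved by every `T_δ`), and his
`Γ_Δ ≤ Sp♯(V_ℤ)` is the isomorphic restriction of our `transvectionGroup B Δ ≤ GL(V)` (`V_ℤ` spans);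
so `IsSkewVanishingLattice B Δ` (+ `B.IsAlt`) says exactly "`Δ` is a vanishing lattice in the
free `ℤ`-module `ℤ·Δ`" in the printed sense, and finite-index / linear-independence statements
transfer verbatim (linear independence over `ℤ` and over `ℚ` agree in a `ℚ`-vector space).

* `skewTransvection B v : V →ₗ[K] V`, `x ↦ x - B x v • v` (Schnell's `T_v`; for the
  Picard–Lefschetz formula of an odd-dimensional fibre, Voisin II Thm. 3.16, this is the local
  monodromy of a node with vanishing cycle `v`, up to the sign convention absorbed in `B`).
* `transvectionGroup B Δ ≤ (V →ₗ[K] V)ˣ` — `Γ_Δ`, the subgroup of `GL(V)` generated by the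
  INVERTIBLE maps whose underlying linear map is some `T_δ`, `δ ∈ Δ` (for alternating `B` every
  `T_δ` is invertible with inverse `x ↦ x + B x δ • δ`, `skewTransvection_mul_neg`; the definition is
  total and needs no hypothesis).
* `IsSkewVanishingLattice B Δ` — the three axioms + integrality, with "single orbit" split into
  `stable` (`Γ_Δ · Δ ⊆ Δ`) and `transitive`.
* NAMED FACT `Schnell2010_lemma11` — [Schnell2010] Lemma 11 (from Janssen's Theorem 2.5 = loc.
  cit. Thm. 10, and Janssen's Lemma 2.7): a vanishing lattice in a space of dimension `r` contains
  `r` linearly independent elements whose transvections generate a FINITE-INDEX subgroup of `Γ_Δ`.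
  This is the "detecting frame" input of Schnell's Proposition 12 (injectivity of the restriction
  map `H¹(G, V_ℚ) → ∏_g V_ℚ/(g - 1)V_ℚ`), whose remaining, elementary half is proved in the tree
  (`Summit.HodgeConjecture.HodgeConjecture.Theorems.localTubeSpan_injective_evalCoinv_of_frame`).

Deliberately NOT here: Janssen's classification and Theorem 2.5 itself (the congruence subgroup
`Sp♯₂(V) ≤ Γ_Δ`, which needs `Hom(V, ℤ)/j(2V)`), Theorem 2.9 (`T_{a+2β} ∈ Γ` for radical `β`),
symmetric vanishing lattices (the odd case, [Schnell2010] §6, where no lattice theory is needed),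
and any geometry.

## References

* [Schnell2010] C. Schnell, Primitive cohomology and the tube mapping, Math. Z. 268 (2010)
  1069–1089, §7 (definitions; Thm. 10 = Janssen Thm. 2.5; Lemma 11; Prop. 12).
* W. A. M. Janssen, Skew-symmetric vanishing lattices and their monodromy groups, Math. Ann. 266
  (1983) 115–133 (doi:10.1007/bf01458708), Thm. 2.5, Lemma 2.7 — cited through [Schnell2010].
* [VoisinHodgeII2003] C. Voisin, Hodge Theory and Complex Algebraic Geometry II (2003), Thm. 3.16
  (Picard–Lefschetz formula).
-/

noncomputable section

namespace Literature.AlgebraicGeometry.HodgeTheory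

section Transvections

variable {K : Type*} [CommRing K] {V : Type*} [AddCommGroup V] [Module K V]
  (B : LinearMap.BilinForm K V)

/-- Schnell's **symplectic transvection** `T_v(x) = x - B(x, v) v` of a module with a bilinear form
(the Picard–Lefschetz transformation of a node with vanishing cycle `v` when `B` is the suitably
signed intersection form of an odd-dimensional fibre). Schnell's sign convention; compare the
signed-letter transvection `x ↦ x + ε·Bf(v, x)·v` of
`Literature.GroupTheory.CombinatorialGroupTheory.SignedHurwitz.transvection` (Hurwitz calculus of
Lefschetz fibrations), which is `T_v` for `Bf = -B.flip`, `ε = +`.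
[cite: Schnell2010, §7 (Skew-symmetric vanishing lattices)] -/
def skewTransvection (v : V) : V →ₗ[K] V :=
  LinearMap.id - (B.flip v).smulRight v

/-- `T_v(x) = x - B(x, v) • v`. [cite: Schnell2010, §7 (Skew-symmetric vanishing lattices)] -/
@[simp]
theorem skewTransvection_apply (v x : V) : skewTransvection B v x = x - B x v • v := by
  simp [skewTransvection]

/-- `T_v` fixes `v` when `B(v, v) = 0` (always, for alternating `B`). [folklore] -/
theorem skewTransvection_apply_self {v : V} (hv : B v v = 0) : skewTransvection B v v = v := by
  rw [skewTransvection_apply, hv, zero_smul, sub_zero]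

/-- `(T_v - 1)V ⊆ K·v`: a transvection is a rank-one perturbation of the identity along `v`.
[folklore] -/
theorem skewTransvection_sub_mem_span (v x : V) :
    skewTransvection B v x - x ∈ K ∙ v := by
  rw [skewTransvection_apply, sub_sub_cancel_left, ← neg_smul]
  exact Submodule.smul_mem _ _ (Submodule.mem_span_singleton_self v)

/-- For `B(v, v) = 0` the transvections along `v` and `-B`… compose additively:
`T_v ∘ (x ↦ x + B(x,v) v) = id`; concretely `T_v (x + B x v • v) = x`. [folklore] -/
theorem skewTransvection_apply_add {v : V} (hv : B v v = 0) (x : V) :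
    skewTransvection B v (x + B x v • v) = x := by
  rw [skewTransvection_apply]
  simp [hv]

/-- For `B(v, v) = 0`, `T_v` is invertible: the linear equivalence with inverse
`x ↦ x + B(x, v) v`. [folklore] -/
def skewTransvectionEquiv {v : V} (hv : B v v = 0) : V ≃ₗ[K] V where
  toLinearMap := skewTransvection B v
  invFun x := x + B x v • v
  left_inv x := by
    change skewTransvection B v x + B (skewTransvection B v x) v • v = x
    rw [skewTransvection_apply]
    simp [hv]
  right_inv x := skewTransvection_apply_add B hv x

/-- The underlying map of `skewTransvectionEquiv` is `T_v`. [folklore] -/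
@[simp]
theorem skewTransvectionEquiv_apply {v : V} (hv : B v v = 0) (x : V) :
    skewTransvectionEquiv B hv x = skewTransvection B v x := rfl

/-- **The monodromy group `Γ_Δ`** of a subset `Δ ⊆ V`: the subgroup of `GL(V) = (End V)ˣ`
generated by the invertible endomorphisms whose underlying linear map is a transvection `T_δ`,
`δ ∈ Δ` (for alternating `B` these are all the `T_δ`). [cite: Schnell2010, §7 (Skew-symmetric vanishing lattices)] -/
def transvectionGroup (Δ : Set V) : Subgroup (V →ₗ[K] V)ˣ :=
  Subgroup.closure {u | ∃ δ ∈ Δ, (u : V →ₗ[K] V) = skewTransvection B δ}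

/-- `Γ_Δ` is monotone in `Δ`. [folklore] -/
theorem transvectionGroup_mono {Δ Δ' : Set V} (h : Δ ⊆ Δ') :
    transvectionGroup B Δ ≤ transvectionGroup B Δ' :=
  Subgroup.closure_mono fun _ ⟨δ, hδ, hu⟩ => ⟨δ, h hδ, hu⟩

/-- For `B(δ, δ) = 0` the unit `T_δ ∈ GL(V)` lies in `Γ_Δ` whenever `δ ∈ Δ`. [folklore] -/
theorem unit_skewTransvection_mem_transvectionGroup {Δ : Set V} {δ : V} (hδ : δ ∈ Δ)
    (hδδ : B δ δ = 0) :
    LinearMap.GeneralLinearGroup.ofLinearEquiv (skewTransvectionEquiv B hδδ) ∈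
      transvectionGroup B Δ :=
  Subgroup.subset_closure ⟨δ, hδ, rfl⟩

end Transvections

section VanishingLattice

variable {V : Type*} [AddCommGroup V] [Module ℚ V] (B : LinearMap.BilinForm ℚ V)

/-- **Skew-symmetric vanishing lattice** (Janssen; [Schnell2010] §7, main definition), rational
form: a subset `Δ` of a `ℚ`-vector space with a bilinear form `B` (alternating in the
applications) such that `B` is INTEGRAL on `Δ` (the `ℤ`-structure `V_ℤ = ℤ·Δ` of the printed
definition), `Δ` spans `V`, `Δ` is a single orbit of its monodromy group `Γ_Δ` (`stable` and
`transitive`), and some two elements of `Δ` pair to `1`. [cite: Schnell2010, §7 (Skew-symmetric vanishing lattices, main definition)] -/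
structure IsSkewVanishingLattice (Δ : Set V) : Prop where
  /-- `ℤ·Δ` is a finitely generated abelian group (Schnell's "free `ℤ`-module of finite rank" `V`;
  automatic for `Δ ⊆ Hⁿ(X_s, ℤ)_van`). -/
  fg : (Submodule.span ℤ Δ).FG
  /-- `⟨δ, δ'⟩ ∈ ℤ` for `δ, δ' ∈ Δ` (the form is integral on the lattice `ℤ·Δ`). -/
  integral : ∀ δ ∈ Δ, ∀ δ' ∈ Δ, ∃ n : ℤ, B δ δ' = n
  /-- `Δ` generates `V`. -/
  span_eq_top : Submodule.span ℚ Δ = ⊤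
  /-- `Δ` is stable under `Γ_Δ`. -/
  stable : ∀ g ∈ transvectionGroup B Δ, ∀ δ ∈ Δ, (g : V →ₗ[ℚ] V) δ ∈ Δ
  /-- `Γ_Δ` acts transitively on `Δ`. -/
  transitive : ∀ δ ∈ Δ, ∀ δ' ∈ Δ, ∃ g ∈ transvectionGroup B Δ, (g : V →ₗ[ℚ] V) δ = δ'
  /-- Some two elements have intersection number one. -/
  exists_pair : ∃ δ₁ ∈ Δ, ∃ δ₂ ∈ Δ, B δ₁ δ₂ = 1

/-- **Schnell's Lemma 11** (named fact; printed proof from Janssen's Theorem 2.5 — "the monodromy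
group of a vanishing lattice contains the congruence subgroup `Sp♯₂(V)`", [Schnell2010] Thm. 10 —
and Janssen's Lemma 2.7): "Let `V` be a free `ℤ`-module of rank `r`, and let `Δ ⊆ V` be a
vanishing lattice. Then it is possible to find `r` linearly independent elements
`δ₁, …, δ_r ∈ Δ`, such that the group `Γ_{{δ₁, …, δ_r}}` has finite index in `Γ_Δ`." Rational form
(module docstring): for an alternating form on a finite-dimensional `ℚ`-space and a vanishing
lattice `Δ` (`ℤ·Δ` finitely generated, integral, spanning, single orbit, a pair with
`⟨δ₁, δ₂⟩ = 1`) there are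
`r = dim V` linearly independent elements of `Δ` whose transvection group has finite index in
`Γ_Δ`. [cite: Schnell2010, Lemma 11] -/
def Schnell2010_lemma11 : Prop :=
  ∀ (V : Type) [AddCommGroup V] [Module ℚ V] [FiniteDimensional ℚ V] (B : LinearMap.BilinForm ℚ V),
    B.IsAlt → ∀ Δ : Set V, IsSkewVanishingLattice B Δ →
      ∃ (r : ℕ) (δ : Fin r → V), r = Module.finrank ℚ V ∧ (∀ i, δ i ∈ Δ) ∧
        LinearIndependent ℚ δ ∧
        ((transvectionGroup B (Set.range δ)).subgroupOf (transvectionGroup B Δ)).FiniteIndex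

/-- **Janssen's Theorem 2.9** (named fact; W. Janssen, *Skew-symmetric vanishing lattices and
their monodromy groups*, Math. Ann. 266 (1983), Thm. 2.9, as quoted verbatim in D. Baraglia,
*Monodromy of the SL(n) and GL(n) Hitchin fibrations*, Math. Ann. 370 (2017), Lemma 6.2): "Let
`(V, ⟨ , ⟩, Δ)` be an integral vanishing lattice and `x ∈ V`. Then `x ∈ Δ` if and only if there
exists `y ∈ V` and `δ ∈ Δ` such that `⟨x, y⟩ = 1` and `x - δ ∈ 2V`."  Rational form (module
docstring: Janssen's free `ℤ`-module is `V = ℤΔ`, possibly with DEGENERATE form): for an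
alternating form on a `ℚ`-space and a skew vanishing lattice `Δ`, an element `x` of `ℤΔ` lies in
`Δ` iff `B(x, y) = 1` for some `y ∈ ℤΔ` and `x - δ ∈ 2·ℤΔ` for some `δ ∈ Δ`.  (Consequence used by
the crux LocalTubeSpan: `δ + 2β ∈ Δ` for `δ ∈ Δ` and `β ∈ ℤΔ` in the radical — the "Janssen
companions" `T_{δ+2β}` of the local Schnell theorem at reducible members.)
[cite: Janssen1983, Thm. 2.9] [cite: Baraglia2017, Lemma 6.2] -/
def Janssen1983_thm2_9 : Prop :=
  ∀ (V : Type) [AddCommGroup V] [Module ℚ V] (B : LinearMap.BilinForm ℚ V),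
    B.IsAlt → ∀ Δ : Set V, IsSkewVanishingLattice B Δ →
      ∀ x ∈ Submodule.span ℤ Δ, x ∈ Δ ↔
        (∃ y ∈ Submodule.span ℤ Δ, B x y = 1) ∧ ∃ δ ∈ Δ, ∃ z ∈ Submodule.span ℤ Δ, x - δ = 2 • z

/-- **Janssen companions** (consequence of Theorem 2.9): for a skew vanishing lattice `Δ`, every
`δ ∈ Δ` and every `β ∈ ℤΔ` orthogonal to `Δ` (i.e. in the radical of the lattice), `δ + 2β` is again
a vanishing cycle.  (`⟨δ + 2β, y⟩ = ⟨δ, y⟩`, which takes the value `1` by Theorem 2.9 applied to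
`δ`, and `(δ + 2β) - δ ∈ 2ℤΔ`.) [cite: Janssen1983, Thm. 2.9] -/
theorem IsSkewVanishingLattice.add_two_smul_mem (h29 : Janssen1983_thm2_9) {V : Type}
    [AddCommGroup V] [Module ℚ V] {B : LinearMap.BilinForm ℚ V} (hB : B.IsAlt) {Δ : Set V}
    (hΔ : IsSkewVanishingLattice B Δ) {δ β : V} (hδ : δ ∈ Δ) (hβ : β ∈ Submodule.span ℤ Δ)
    (hβrad : ∀ x ∈ Δ, B β x = 0) : δ + 2 • β ∈ Δ := by
  have hδℤ : δ ∈ Submodule.span ℤ Δ := Submodule.subset_span hδ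
  have hxℤ : δ + 2 • β ∈ Submodule.span ℤ Δ :=
    (Submodule.span ℤ Δ).add_mem hδℤ (nsmul_mem hβ 2)
  -- `β` is orthogonal to all of `ℤΔ`
  have hβorth : ∀ y ∈ Submodule.span ℤ Δ, B β y = 0 := fun y hy => by
    refine Submodule.span_induction (fun x hx => hβrad x hx) (by simp)
      (fun x y _ _ hx hy => by rw [map_add, hx, hy, add_zero])
      (fun n x _ hx => by rw [map_zsmul, hx, smul_zero]) hy
  -- a `y ∈ ℤΔ` with `⟨δ, y⟩ = 1`, from Theorem 2.9 applied to `δ ∈ Δ`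
  obtain ⟨⟨y, hy, hδy⟩, -⟩ := (h29 V B hB Δ hΔ δ hδℤ).1 hδ
  refine (h29 V B hB Δ hΔ _ hxℤ).2 ⟨⟨y, hy, ?_⟩, δ, hδ, β, hβ, by rw [add_sub_cancel_left]⟩
  rw [two_nsmul, map_add, map_add, LinearMap.add_apply, LinearMap.add_apply, hδy, hβorth y hy,
    add_zero, add_zero]

/-- **Schnell's Lemma 11, NONDEGENERATE case** (named fact): the special case of
`Schnell2010_lemma11` in which the alternating form is nondegenerate — Schnell's own setting, the
vanishing cohomology `Hᵈ⁻¹(S₀, ℚ)_van` of the smooth hyperplane sections of an even-dimensional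
variety with its intersection form, where [Schnell2010] §7 applies Lemma 11 to establish
Proposition 12: "Let `V` be a free `ℤ`-module of rank `r`, and let `Δ ⊆ V` be a vanishing lattice.
Then it is possible to find `r` linearly independent elements `δ₁, …, δ_r ∈ Δ`, such that the group
`Γ_{{δ₁, …, δ_r}}` has finite index in `Γ_Δ`" (printed proof: loc. cit., from Janssen's Theorem 2.5
and Lemma 2.7).  Rational form as in `Schnell2010_lemma11`, with the extra hypothesis
`B.Nondegenerate`; the general statement of `Schnell2010_lemma11` is recovered from this special case
on the summit side (theorem `localTubeSpan_schnell2010_lemma11_of_nondegenerate` of the Hodge summit's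
`Theorems/LinearSystemTorelliLocalTubeSpanLemma11OfNondegenerate`, a frame-lifting argument through
the quotient by the radical), so consumers may take this weaker
fact instead. [cite: Schnell2010, Lemma 11] -/
def Schnell2010_lemma11_nondegenerate : Prop :=
  ∀ (V : Type) [AddCommGroup V] [Module ℚ V] [FiniteDimensional ℚ V] (B : LinearMap.BilinForm ℚ V),
    B.IsAlt → B.Nondegenerate → ∀ Δ : Set V, IsSkewVanishingLattice B Δ →
      ∃ (r : ℕ) (δ : Fin r → V), r = Module.finrank ℚ V ∧ (∀ i, δ i ∈ Δ) ∧
        LinearIndependent ℚ δ ∧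
        ((transvectionGroup B (Set.range δ)).subgroupOf (transvectionGroup B Δ)).FiniteIndex

/-- Schnell's Lemma 11 implies its nondegenerate case (trivially). [cite: Schnell2010, Lemma 11] -/
theorem Schnell2010_lemma11.nondegenerate (h : Schnell2010_lemma11) :
    Schnell2010_lemma11_nondegenerate :=
  fun V _ _ _ B hB _ Δ hΔ => h V B hB Δ hΔ

/-- **Janssen's Theorem 2.5** (named fact; W. Janssen, *Skew-symmetric vanishing lattices and their
monodromy groups*, Math. Ann. 266 (1983), Thm. 2.5, as stated in [Schnell2010] §7 Theorem 10):
"Let `Δ ⊆ V` be a vanishing lattice. Then the monodromy group of `Δ` contains the congruence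
subgroup `Sp♯₂(V) = {g ∈ Sp(V) | g acts trivially on Hom(V, ℤ)/j(2V)}`. In particular, `Γ_Δ` is
itself of finite index in `Sp♯(V)`."  Here `V` is a free `ℤ`-module of finite rank with an
alternating form `B`, `Sp(V)` "the group of all automorphisms of `V` that preserve `B`",
`j(v) = ⟨v, -⟩`, and — loc. cit., the displayed description used in the proof of Lemma 11 — an
element `h` lies in the congruence subgroup iff "for any `λ' ∈ Hom(V, ℤ)`, there exists `v' ∈ V`
such that `λ'(hx - x) = 2⟨v', x⟩` for all `x ∈ V`".  Rational form (module docstring: Janssen's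
free `ℤ`-module is `V_ℤ := ℤΔ` inside the `ℚ`-space it spans; `Hom(V_ℤ, ℤ)` = the `ℚ`-linear
functionals integral on `ℤΔ`; `⟨a, b⟩ = B a b` as in `skewTransvection`): every unit `g` of
`End_ℚ(V)` which is an isometry of `B`, maps `ℤΔ` onto itself, and satisfies the displayed
condition for every functional integral on `ℤΔ`, lies in `Γ_Δ = transvectionGroup B Δ`.
(Only the first sentence is vendored; the "in particular" is a consequence not restated.)
[cite: Schnell2010, §7 Thm. 10] [cite: Janssen1983, Thm. 2.5] -/
def Janssen1983_thm2_5 : Prop :=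
  ∀ (V : Type) [AddCommGroup V] [Module ℚ V] [FiniteDimensional ℚ V]
    (B : LinearMap.BilinForm ℚ V), B.IsAlt → ∀ Δ : Set V, IsSkewVanishingLattice B Δ →
      ∀ g : (V →ₗ[ℚ] V)ˣ,
        (∀ x y : V, B ((g : V →ₗ[ℚ] V) x) ((g : V →ₗ[ℚ] V) y) = B x y) →
        (∀ x ∈ Submodule.span ℤ Δ, (g : V →ₗ[ℚ] V) x ∈ Submodule.span ℤ Δ) →
        (∀ x ∈ Submodule.span ℤ Δ, ((g⁻¹ : (V →ₗ[ℚ] V)ˣ) : V →ₗ[ℚ] V) x ∈ Submodule.span ℤ Δ) →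
        (∀ l : V →ₗ[ℚ] ℚ, (∀ x ∈ Submodule.span ℤ Δ, ∃ z : ℤ, l x = z) →
          ∃ v ∈ Submodule.span ℤ Δ, ∀ x ∈ Submodule.span ℤ Δ,
            l ((g : V →ₗ[ℚ] V) x - x) = 2 * B v x) →
        g ∈ transvectionGroup B Δ

end VanishingLattice

end Literature.AlgebraicGeometry.HodgeTheory

end
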